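import Summits.CriticalPhenomena.PercolationContinuityZ3.Theorems.PercNearOneGluingNoHeavyPcintWinKernel
import HarnessLib

/-!
# PCINT lane, kernel window certificates — range checks by binary splitting

Cell `prim-pcint`, seat `prim-pcint-2` (gen 2); memo `run/shared/lean/prim/pcint/INTERVAL-PLAN.md` §14.  Does NOT build on p205010.
`WinK.allRange f lo hi` (`…PcintWinKernel`) evaluates `List.all` on a list of `hi - lo` codes; in the kernel this recursion is as
deep as the list is long, so a single `decide +kernel` can only cover a few hundred codes.  `WinK.allRangeB f fuel lo len` splits
the range in halves (`fuel` times, down to blocks of at most `256` codes) — the same Boolean (`allRangeB_eq`), evaluated with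
recursion depth `O(log len)`, so that one kernel call can scan a whole code range when most codes are cheap (e.g. the normal-form
checks of `…PcintWinKernelSymCert`, where only the first-use normal forms carry a Collatz–Wielandt row).
-/

namespace Summit.CriticalPhenomena.PercolationContinuityZ3.Theorems.Pcint

namespace WinK

/-- Range check by binary splitting: `fuel` halvings, leaves of at most `256` codes. [folklore] -/
def allRangeB (f : ℕ → Bool) : ℕ → ℕ → ℕ → Bool
  | 0, lo, len => (List.range' lo len).all f
  | fuel + 1, lo, len =>
    if len ≤ 256 then (List.range' lo len).all f
    else allRangeB f fuel lo (len / 2) && allRangeB f fuel (lo + len / 2) (len - len / 2)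

/-- `allRange` on `[lo, lo + len)` is `List.all` on `range' lo len`. [folklore] -/
theorem allRange_eq_all (f : ℕ → Bool) (lo len : ℕ) : allRange f lo (lo + len) = (List.range' lo len).all f := by
  rw [allRange, Nat.add_sub_cancel_left]

/-- **Binary splitting computes the range check.** [folklore] -/
theorem allRangeB_eq (f : ℕ → Bool) : ∀ fuel lo len : ℕ, allRangeB f fuel lo len = allRange f lo (lo + len)
  | 0, lo, len => by rw [allRangeB, allRange_eq_all]
  | fuel + 1, lo, len => by
    rw [allRangeB]
    split_ifs with h
    · rw [allRange_eq_all]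
    · rw [allRangeB_eq f fuel, allRangeB_eq f fuel, allRange_eq_all, allRange_eq_all, allRange_eq_all]
      have hsplit : len = len / 2 + (len - len / 2) := by omega
      conv_rhs => rw [hsplit, ← List.range'_append_1, List.all_append]

/-- A binary-split check yields the range check. [folklore] -/
theorem allRange_of_allRangeB {f : ℕ → Bool} {fuel lo len : ℕ} (h : allRangeB f fuel lo len = true) :
    allRange f lo (lo + len) = true := by
  rw [← allRangeB_eq]; exact h

end WinK

end Summit.CriticalPhenomena.PercolationContinuityZ3.Theorems.Pcint
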